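import Summits.Ventures.Crystal3D.Theorems.StickyWulffConstantGenericWallFloorSigma27Full
import HarnessLib

/-!
# The residual of lane G shrunk once more: the `Σ27` cell `(1,1)` class carved out
# (crux `GenericWallFloor`, stmt-Ventures-19480, line `WallLedgerG`)

HONEST FRAMING. Venture `Summits/Ventures/Crystal3D` (cell `crystal3d-full`), helper `--supports` the crux
`GenericWallFloor` of `route-Ventures-StickyWulffConstant`, REGISTERED line `WallLedgerG`, open stub
`stub_twoSlabAdhesion`.  BOOKKEEPING, rung credit only; F-C1 not moved; NOT the crux.

`…CoreResidual` recorded the crux BY NAME from `ExactOnly`(C12-55) [E1], `StarPairFar` [certified] and the residual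
`GenericWallFloorCoreResidual` (ray-aligned non-co-axial pairs outside both one-sided `Σ9` classes).  After
`genericWallFloorAt_sigma27` (`…Sigma27Full`) the `Σ27` pairs with level-two conditions on BOTH forced rays
(`Sigma27CellAt`, below: cells `min l ≤ 1 ∧ min c ≤ 1` of ROUTE.md §84 R41t, numerically `≈ 80 %` of Haar `Σ27`
orientations, of which the ray-aligned cell `(1,1)` is `≈ 9.5 %`) also satisfy the crux's matrix at `c₀ = 1`, so they
leave the residual: **`genericWallFloor_of_coreResidualTwo`** — `ExactOnly`(C12-55) → `StarPairFar` →
`GenericWallFloorCoreResidualTwo` → the route decl BY NAME; and `genericWallFloorCoreResidualTwo_of_coreResidual` /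
`…_of_genericWallFloor` (nothing smuggled: the new residual is implied by the old one and by the crux).
WHAT THIS IS NOT: a proof of the residual (the arrival classes — `Σ9` cells `(0,2)/(2,0)/(2,2)`, `Σ27` cells with
`l ≥ 2 ∨ c ≥ 2`, … — are untouched); F-C1 not moved.
-/

noncomputable section

namespace Summit.Ventures.Crystal3D.Theorems

open Summit.Ventures.Crystal3D Finset
open Literature.MathematicalPhysics.StatisticalMechanics (fccStacking barlowStacking IsHaggSeq)
open scoped InnerProductSpace

/-- **The `Σ27` both-sides-level-two class**: the hypothesis list of `genericWallFloorAtCharge_one_sigma27` for the pair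
`(A₁, A₂)` — a reduced model menu word `[μ₃, μ₂, μ₁]` with `A₂·Λ₀ = (wordFrame A₁ [μ₃, μ₂, μ₁])·Λ₀`, steep slots `u₁`
(up) / `u₂` (down), and the level-two conditions on both forced rays in their two readings. -/
def Sigma27CellAt (A₁ A₂ : EuclideanSpace ℝ (Fin 3) ≃ₗᵢ[ℝ] EuclideanSpace ℝ (Fin 3)) : Prop :=
  ∃ (u₁ u₂ μ₃ μ₂ μ₁ : EuclideanSpace ℝ (Fin 3)), u₁ ∈ fccSlots ∧
    Real.sqrt 2 / 2 ≤ ⟪A₁ u₁, EuclideanSpace.single (2 : Fin 3) (1 : ℝ)⟫_ℝ ∧ u₂ ∈ fccSlots ∧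
    ⟪A₂ u₂, EuclideanSpace.single (2 : Fin 3) (1 : ℝ)⟫_ℝ ≤ -(Real.sqrt 2 / 2) ∧
    (∀ μ ∈ [μ₃, μ₂, μ₁], ‖μ‖ = 1 ∧
      ∀ w ∈ fccSlots, ⟪w, μ⟫_ℝ = 0 ∨ ⟪w, μ⟫_ℝ = Real.sqrt (2 / 3) ∨ ⟪w, μ⟫_ℝ = -Real.sqrt (2 / 3)) ∧
    List.IsChain (fun μ μ' => ⟪μ, μ'⟫_ℝ = 1 / 3 ∨ ⟪μ, μ'⟫_ℝ = -1 / 3) [μ₃, μ₂, μ₁] ∧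
    A₂ '' fccStacking 1 (Real.sqrt (2 / 3)) = (wordFrame A₁ [μ₃, μ₂, μ₁]) '' fccStacking 1 (Real.sqrt (2 / 3)) ∧
    (∀ n₁ : EuclideanSpace ℝ (Fin 3), (n₁ = A₁ μ₁ ∨ n₁ = -A₁ μ₁) → ⟪A₁ u₁, n₁⟫_ℝ = Real.sqrt (2 / 3) →
      ∀ q ∈ fccSlots, 0 < ⟪twinFrame A₁ n₁ q, n₁⟫_ℝ →
        (∀ q' ∈ fccSlots, 0 < ⟪twinFrame A₁ n₁ q', n₁⟫_ℝ →
          ⟪twinFrame A₁ n₁ q', EuclideanSpace.single (2 : Fin 3) (1 : ℝ)⟫_ℝ ≤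
            ⟪twinFrame A₁ n₁ q, EuclideanSpace.single (2 : Fin 3) (1 : ℝ)⟫_ℝ) →
        (twinFrame A₁ n₁).symm ((2 * Real.sqrt (2 / 3)) • twinFrame A₁ n₁ q - n₁) ≠ μ₂ ∧
        (twinFrame A₁ n₁).symm ((2 * Real.sqrt (2 / 3)) • twinFrame A₁ n₁ q - n₁) ≠ -μ₂) ∧
    (∀ n₁ : EuclideanSpace ℝ (Fin 3), (n₁ = A₁ μ₁ ∨ n₁ = -A₁ μ₁) → ⟪A₁ u₁, n₁⟫_ℝ = Real.sqrt (2 / 3) →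
      ∀ q ∈ fccSlots, 0 < ⟪twinFrame A₁ n₁ q, n₁⟫_ℝ →
        (∀ q' ∈ fccSlots, 0 < ⟪twinFrame A₁ n₁ q', n₁⟫_ℝ →
          ⟪twinFrame A₁ n₁ q', EuclideanSpace.single (2 : Fin 3) (1 : ℝ)⟫_ℝ ≤
            ⟪twinFrame A₁ n₁ q, EuclideanSpace.single (2 : Fin 3) (1 : ℝ)⟫_ℝ) →
        ⟪q, μ₂⟫_ℝ = 0) ∧
    (∀ n₁ : EuclideanSpace ℝ (Fin 3),
      (n₁ = wordFrame A₁ [μ₃, μ₂, μ₁] μ₃ ∨ n₁ = -wordFrame A₁ [μ₃, μ₂, μ₁] μ₃) → ⟪A₂ u₂, n₁⟫_ℝ = Real.sqrt (2 / 3) →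
      ∀ q ∈ fccSlots, 0 < ⟪twinFrame A₂ n₁ q, n₁⟫_ℝ →
        (∀ q' ∈ fccSlots, 0 < ⟪twinFrame A₂ n₁ q', n₁⟫_ℝ →
          ⟪twinFrame A₂ n₁ q', -EuclideanSpace.single (2 : Fin 3) (1 : ℝ)⟫_ℝ ≤
            ⟪twinFrame A₂ n₁ q, -EuclideanSpace.single (2 : Fin 3) (1 : ℝ)⟫_ℝ) →
        (wordFrame A₁ [μ₃, μ₂, μ₁]).symm
            (A₂ ((twinFrame A₂ n₁).symm ((2 * Real.sqrt (2 / 3)) • twinFrame A₂ n₁ q - n₁))) ≠ μ₂ ∧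
        (wordFrame A₁ [μ₃, μ₂, μ₁]).symm
            (A₂ ((twinFrame A₂ n₁).symm ((2 * Real.sqrt (2 / 3)) • twinFrame A₂ n₁ q - n₁))) ≠ -μ₂) ∧
    (∀ n₁ : EuclideanSpace ℝ (Fin 3),
      (n₁ = wordFrame A₁ [μ₃, μ₂, μ₁] μ₃ ∨ n₁ = -wordFrame A₁ [μ₃, μ₂, μ₁] μ₃) → ⟪A₂ u₂, n₁⟫_ℝ = Real.sqrt (2 / 3) →
      ∀ q ∈ fccSlots, 0 < ⟪twinFrame A₂ n₁ q, n₁⟫_ℝ →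
        (∀ q' ∈ fccSlots, 0 < ⟪twinFrame A₂ n₁ q', n₁⟫_ℝ →
          ⟪twinFrame A₂ n₁ q', -EuclideanSpace.single (2 : Fin 3) (1 : ℝ)⟫_ℝ ≤
            ⟪twinFrame A₂ n₁ q, -EuclideanSpace.single (2 : Fin 3) (1 : ℝ)⟫_ℝ) →
        ⟪twinFrame A₂ n₁ q, twinFrame A₁ (A₁ μ₁) μ₂⟫_ℝ = 0)

/-- **The residual of lane G, shrunk twice**: the crux's matrix, verbatim, on every non-co-axial RAY-ALIGNED pair lying in
neither one-sided `Σ9` class nor in the `Σ27` both-sides-level-two class. -/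
def GenericWallFloorCoreResidualTwo : Prop :=
  ∀ (A₁ : EuclideanSpace ℝ (Fin 3) ≃ₗᵢ[ℝ] EuclideanSpace ℝ (Fin 3)) (t₁ : EuclideanSpace ℝ (Fin 3))
    (A₂ : EuclideanSpace ℝ (Fin 3) ≃ₗᵢ[ℝ] EuclideanSpace ℝ (Fin 3)) (t₂ : EuclideanSpace ℝ (Fin 3)),
    ¬ (∃ (L : EuclideanSpace ℝ (Fin 3) ≃ₗᵢ[ℝ] EuclideanSpace ℝ (Fin 3)) (s₁ s₂ : EuclideanSpace ℝ (Fin 3))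
        (σ σ' : ℤ → ℤ), IsHaggSeq σ ∧ IsHaggSeq σ' ∧
        (fun p => A₁ p + t₁) '' fccStacking 1 (Real.sqrt (2 / 3)) ⊆
          (fun p => L p + s₁) '' barlowStacking 1 (Real.sqrt (2 / 3)) σ ∧
        (fun p => A₂ p + t₂) '' fccStacking 1 (Real.sqrt (2 / 3)) ⊆
          (fun p => L p + s₂) '' barlowStacking 1 (Real.sqrt (2 / 3)) σ') →
    RayAlignedAt A₁ A₂ → ¬ Sigma9OneSidedAt A₁ A₂ → ¬ Sigma9OneSidedDownAt A₁ A₂ → ¬ Sigma27CellAt A₁ A₂ →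
    GenericWallFloorAt A₁ t₁ A₂ t₂

/-- Pairs in the `Σ27` both-sides-level-two class satisfy the crux's matrix (modulo `ExactOnly`(C12-55), `StarPairFar`). -/
theorem genericWallFloorAt_of_sigma27CellAt
    {s₀ : EuclideanSpace ℝ (Fin 3)} (hs₀ : s₀ ∈ fccSlots)
    (hcert : ExactOnly 0 (fccSlots.filter fun w => 0 < ⟪w, s₀⟫_ℝ)) (hfar : StarPairFar)
    {A₁ A₂ : EuclideanSpace ℝ (Fin 3) ≃ₗᵢ[ℝ] EuclideanSpace ℝ (Fin 3)} (h : Sigma27CellAt A₁ A₂)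
    (t₁ t₂ : EuclideanSpace ℝ (Fin 3)) : GenericWallFloorAt A₁ t₁ A₂ t₂ := by
  obtain ⟨u₁, u₂, μ₃, μ₂, μ₁, hu₁, hsteep₁, hu₂, hsteep₂, hκl, hκc, hA₂, hsecond₁, hcap₁, hsecond₂, hcap₂⟩ := h
  exact genericWallFloorAt_sigma27 hs₀ hcert hfar A₁ t₁ A₂ t₂ hu₁ hsteep₁ hu₂ hsteep₂ μ₃ μ₂ μ₁ hκl hκc hA₂ hsecond₁
    hcap₁ hsecond₂ hcap₂

/-- **The crux BY NAME from `ExactOnly`(C12-55), `StarPairFar` and the twice-shrunk residual.** -/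
theorem genericWallFloor_of_coreResidualTwo
    {s₀ : EuclideanSpace ℝ (Fin 3)} (hs₀ : s₀ ∈ fccSlots)
    (hcert : ExactOnly 0 (fccSlots.filter fun w => 0 < ⟪w, s₀⟫_ℝ)) (hfar : StarPairFar)
    (hres : GenericWallFloorCoreResidualTwo) :
    Summit.Ventures.Crystal3D.Theses.StickyWulffConstant.GenericWallFloor := by
  refine genericWallFloor_of_coreResidual hs₀ hcert hfar fun A₁ t₁ A₂ t₂ hnc hra h₁ h₂ => ?_
  by_cases h₃ : Sigma27CellAt A₁ A₂
  · exact genericWallFloorAt_of_sigma27CellAt hs₀ hcert hfar h₃ t₁ t₂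
  exact hres A₁ t₁ A₂ t₂ hnc hra h₁ h₂ h₃

/-- The twice-shrunk residual is implied by the once-shrunk one: nothing is smuggled. -/
theorem genericWallFloorCoreResidualTwo_of_coreResidual (h : GenericWallFloorCoreResidual) :
    GenericWallFloorCoreResidualTwo :=
  fun A₁ t₁ A₂ t₂ hnc hra h₁ h₂ _ => h A₁ t₁ A₂ t₂ hnc hra h₁ h₂

/-- The crux implies the twice-shrunk residual. -/
theorem genericWallFloorCoreResidualTwo_of_genericWallFloor
    (h : Summit.Ventures.Crystal3D.Theses.StickyWulffConstant.GenericWallFloor) : GenericWallFloorCoreResidualTwo :=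
  genericWallFloorCoreResidualTwo_of_coreResidual (genericWallFloorCoreResidual_of_genericWallFloor h)

end Summit.Ventures.Crystal3D.Theorems

end
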